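import Summits.Ventures.YMGap.YM3IR.ForestAudit
import Summits.Ventures.YMGap.YM3IR.BalabanSUN
import Summits.Ventures.YMGap.RobustBall.TorusRowsYM3W
import HarnessLib

/-!
# YM₃ infrared statement — `YM3IR/CovariantFamily.lean`: gauge COVARIANCE of the block family, the forest's failure
of it, and the covariant form of the one conjecture on the TIER-2 ball (cell `pub-ymgap`, track Y4; ym3ir-theory-1, gen 5)

HONEST FRAMING. WHAT THIS IS: a venture file answering the lead's item (15) («would restricting `∃ W` to Bałaban's
block-averaging families make the kernel arrow a genuine reduction, and what would `BalabanUV3` then feed?») at the level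
of TYPES, on top of theory-2's strength audit `YM3IR/ForestAudit.lean` (whose findings F1–F3 theory-1 confirms). It proves
NOTHING about Yang–Mills: lattice statements and typing only, no continuum limit, no Clay claim; no axiom, no `sorry`,
`0` compute. Nothing of theory-2's `Statement.lean` (frozen v2) is touched and the §Y4 sentence of record
(`massGap3Cofinal_su2_balaban_of_irConjecture3`) stands; this file is NOT a Statement v3.

WHAT IT SAYS. (1) `BlockFamily.IsGaugeCovariantOn W I` — Bałaban's averaging axiom (11) of CMP 98 (1985) [tree, VERBATIM
shape: `Balaban1983to89.Setup.Averaging.covariant : avg (gaugeAct u U) = gaugeAct (fun y => u (emb y)) (avg U)`] for a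
`BlockFamily`: at every coupling `β ∈ I` and coarse side `M ≥ 1` there is a re-labelling `emb` of coarse sites by fine sites
such that `blk (U^g) = (blk U)^{g ∘ emb}` for every fine gauge transformation `g`; and `BlockFamily.IsBlockLocalOn W I` —
block locality (the tree's un-numbered axiom `Setup.Averaging.local_dep`; in print a PROPERTY of Bałaban's average (15),
CMP 98 p. 19, not a numbered display): the coarse link `(y, i)` depends only on the fine links in the blocks of `y` and `y + eᵢ`.
theory-2's `BlockFamily` (Clustering.lean) deliberately carries neither field. (2) PROVED: theory-2's forest family
`forestFamily b hb` (star decimation `V(y,i) := U(b·y, i)`) is block-local but is NOT gauge-covariant at ANY coupling with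
`2 ≤ b β`, on ANY coarse torus `M ≥ 1`, for ANY re-labelling `emb`, as soon as `G` has an element `≠ 1`
(`not_covariantAt_forestFamily`; witness: `U ≡ 1` and the gauge rotation by `a ≠ 1` at the single fine site `e₀`).
So the witness behind F1 (`ForestWitness3`: the target implies `IRConjecture3` AS TYPED) is excluded by covariance.
(3) `IRConjecture3Cov B r ρ I C_b κ := ∃ W, W.IsGaugeCovariantOn I ∧ W.IsBlockLocalOn I ∧ EntersClusterDomain … ∧
FluctuationDecoupling …` (CONJECTURE, not in print) with `IRConjecture3Cov → IRConjecture3` and the `SU(2)` composition on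
the TIER-2 weighted ball `ballOfRobustBall 2 (log (6/5)) (9/25) (9/50) (1/16)` (ds-2's hypothesis-free row
`RobustBall.su2_clusterDomainClusteringW_dim3_oneEighth_w65`), both with Bałaban's input (sentence shape of record) and
print-free (theory-2's F2 shape): `massGap3Cofinal_su2_W_of_irConjecture3Cov`, `…_printFree`.

WHY THE TIER-2 BALL (F-range). Images of Gibbs laws under covariant local averaging are expected to be infinite-range
at every `β > 0` (Bałaban's own boundary terms (41) decay like `e^{−κ d(X)}` and never vanish), whereas the forest's images
are exactly product Haar; so the finite-range tier-1 ball `ballOfRobustBallFR` is the currency of the forest-equivalent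
reading only, and a covariant conjecture should receive on the diameter-weighted ball `ClusterDomain κ ε₀ ε₁` (tier 2),
on which ds-2's rows are equally hypothesis-free.

HONEST LABEL. `IRConjecture3Cov` IMPLIES the target (proved below) and is NOT KNOWN to follow from it: after covariance
the reverse arrow would be a Gibbsian-restoration theorem («fine strong mixing ⇒ the block-averaged law is Gibbsian with a
small summable potential, block factor `≍ β`»), in print only for Ising-type systems (Bertini–Cirillo–Olivieri 1999) and
not at all for lattice gauge theories. So it is a genuine SUFFICIENT condition, possibly strictly stronger than the target,
never «the remaining gap». And `BalabanUV3` is STILL not load-bearing in it (clause (a) asserts membership outright):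
that needs clause (a) threaded from THEOREM 2's terminal format (theory-1's `UVInterface.Ledger.CrossoverControl` shape),
which is Statement-v3 business (owner theory-2, not before Monday) and is not typed here. Only the exclusion of THE forest
witness is proved; no claim is made that covariance ∧ locality exclude every non-renormalisation-group witness (informal
remark: a constant re-labelling `emb` plus locality forces centre-valued coarse links off one block, hence a singular law).

WHY THIS IS NOVEL (one sentence). It isolates, as one decidable-looking algebraic property with a kernel-checked separating
example, the exact feature — gauge covariance of the block MAP, not gauge invariance of the image LAW — that distinguishes
Bałaban's renormalisation-group block fields from the decimation-to-a-forest maps under which every lattice gauge theory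
looks like product Haar, and hence the feature any non-vacuous «enters the cluster domain» conjecture must quantify over.

## References
* T. Bałaban, Averaging operations for lattice gauge theories, CMP 98 (1985) 17, (11) p.19 (gauge covariance of the average;
  (12)–(13) p.19 verify that (11) makes `ρ'` gauge invariant) and the average (15) p.19 (whose block locality is the tree axiom
  `Setup.Averaging.local_dep`). [cite: Balaban1985Averaging]
* T. Bałaban, CMP 102 (1985) 255, Thms 1–2. [cite: Balaban1985UV3]
* L. Bertini, E. Cirillo, E. Olivieri, J. Stat. Phys. 97 (1999) 831 (arXiv:cond-mat/9905434). [folklore pointer; not used in a proof]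
* Cell files: ym3ir/YM3-IR-theory1.md §15, ym3ir/YM3-IR.md §C/§E, theory-2's ym3ir/AUDIT-theory2-g4.md.
-/

noncomputable section

open MeasureTheory
open Literature.MathematicalPhysics.QuantumLattice Literature.MathematicalPhysics.QuantumFieldTheory
open Balaban1985CMP102 Balaban1985CMP102.Setting Balaban1985CMP102.Theorems
open Summit.QuantumFields.Balaban3D.Carriers (suGroupModel)

namespace Summit.Ventures.YMGap.YM3IR

/-! ## 1. Gauge covariance and block locality of a block family (Bałaban CMP 98 (11); locality of the average (15)) -/

section Covariance

variable {G : Type} [MeasurableSpace G] [Group G]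

/-- **Covariance of the block map at `(β, M)` for the re-labelling `emb`** (Bałaban's (11): `avg (U^g) = (avg U)^{g ∘ emb}`):
a fine gauge transformation `g` acts on the coarse field through its values at the representative fine sites `emb y`.
[cite: Balaban1985Averaging, (11) p.19] -/
def BlockFamily.CovariantAt (W : BlockFamily G) (β : ℝ) (M : ℕ) (emb : Site 3 M → Site 3 (W.factor β * M)) : Prop :=
  ∀ (g : Site 3 (W.factor β * M) → G) (U : GaugeConfig 3 (W.factor β * M) G),
    W.blk β M (gaugeTransform g U) = gaugeTransform (fun y => g (emb y)) (W.blk β M U)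

/-- **`W.IsGaugeCovariantOn I` — gauge covariance of the block family along the coupling set `I`:** at every `β ∈ I`
and every coarse side `M ≥ 1` the block map is covariant for SOME re-labelling of coarse sites by fine sites (Bałaban:
block centres; theory-2's geometry: block corners `liftSite`; the tree's `AveragingRT.axialAvg_covariant` is the (11)
certificate for the straight-line axial average in Bałaban's own lattice types). The weakest form of (11) — `emb` is
not even asked to be injective — and already it excludes the forest (`not_isGaugeCovariantOn_forestFamily`).
[cite: Balaban1985Averaging, (11) p.19] -/
def BlockFamily.IsGaugeCovariantOn (W : BlockFamily G) (I : Set ℝ) : Prop :=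
  ∀ β ∈ I, ∀ (M : ℕ) [NeZero M], ∃ emb : Site 3 M → Site 3 (W.factor β * M), W.CovariantAt β M emb

/-- **`W.IsBlockLocalOn I` — block locality (a property of Bałaban's average (15), CMP 98 p. 19 — `Ū_c` reads `U` on the
block `B(c₋)` and the contours `Γ_{c,x}` only; no numbered display — carried in the tree as the axiom `Averaging.local_dep`):**
the coarse link `(y, i)` depends only on the fine links starting in the blocks of `y` and of `y + eᵢ` (theory-2's `blockOf`).
Iterated averagings keep this shape (each level's dependence stays inside the sub-blocks of the final blocks). [cite: Balaban1985Averaging, (15) p.19] -/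
def BlockFamily.IsBlockLocalOn (W : BlockFamily G) (I : Set ℝ) : Prop :=
  ∀ β ∈ I, ∀ (M : ℕ) [NeZero M] (e : Edge 3 M),
    DependsOn (fun U : GaugeConfig 3 (W.factor β * M) G => W.blk β M U e)
      {x : Edge 3 (W.factor β * M) | blockOf (W.factor β) M x.1 = e.1 ∨ blockOf (W.factor β) M x.1 = e.1.shift e.2}

end Covariance

/-! ## 2. The forest (star decimation) is block-local and NOT gauge-covariant -/

section ForestGeometry

variable {G : Type} [MeasurableSpace G]

/-- The corner site `b·y` lies in the block `y`. [folklore] -/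
theorem blockOf_liftSite {b M : ℕ} [NeZero M] (hb : 0 < b) (y : Site 3 M) : blockOf b M (liftSite b M y) = y := by
  funext i
  simp only [blockOf, liftSite]
  have hval : ((b * (y i).val : ℕ) : ZMod (b * M)).val = b * (y i).val := by
    rw [ZMod.val_natCast]
    exact Nat.mod_eq_of_lt (mul_lt_mul_of_pos_left (ZMod.val_lt (y i)) hb)
  rw [hval, Nat.mul_div_cancel_left _ hb, ZMod.natCast_zmod_val]

/-- **The forest family is block-local** (the coarse link `(y,i)` IS the fine link `(b·y, i)`, which starts in block `y`). [folklore] -/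
theorem isBlockLocalOn_forestFamily (b : ℝ → ℕ) (hb : ∀ β, 0 < b β) (I : Set ℝ) :
    (forestFamily (G := G) b hb).IsBlockLocalOn I := by
  intro β _ M _ e U U' h
  exact h (liftSite (b β) M e.1, e.2) (Or.inl (blockOf_liftSite (hb β) e.1))

/-- Reduction modulo `b` of a corner coordinate: the image of `((b·v : ℕ) : ZMod (b·M))` in `ZMod b` is `0`. [folklore] -/
theorem castHom_liftCoord (b M v : ℕ) :
    ZMod.castHom (dvd_mul_right b M) (ZMod b) ((b * v : ℕ) : ZMod (b * M)) = 0 := by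
  rw [map_natCast, Nat.cast_mul, ZMod.natCast_self, zero_mul]

/-- For `2 ≤ b`, a corner coordinate is never `≡ 1`: `((b·v : ℕ) : ZMod (b·M)) ≠ 1`. [folklore] -/
theorem liftCoord_ne_one {b : ℕ} (h2 : 2 ≤ b) (M v : ℕ) : ((b * v : ℕ) : ZMod (b * M)) ≠ 1 := by
  haveI : Fact (1 < b) := ⟨h2⟩
  intro h
  have := congrArg (ZMod.castHom (dvd_mul_right b M) (ZMod b)) h
  rw [castHom_liftCoord, map_one] at this
  exact zero_ne_one this

/-- For `2 ≤ b`, a corner coordinate plus one is never `≡ 0`: `((b·v : ℕ) : ZMod (b·M)) + 1 ≠ 0`. [folklore] -/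
theorem liftCoord_add_one_ne_zero {b : ℕ} (h2 : 2 ≤ b) (M v : ℕ) : ((b * v : ℕ) : ZMod (b * M)) + 1 ≠ 0 := by
  haveI : Fact (1 < b) := ⟨h2⟩
  intro h
  have := congrArg (ZMod.castHom (dvd_mul_right b M) (ZMod b)) h
  rw [map_add, castHom_liftCoord, map_one, map_zero, zero_add] at this
  exact one_ne_zero this

/-- `liftSite` is injective at zero: `b·y = 0` on the fine torus forces `y = 0` (`M ≥ 1`, `b ≥ 1`). [folklore] -/
theorem liftSite_eq_zero {b M : ℕ} [NeZero M] (hb : 0 < b) {y : Site 3 M} (h : liftSite b M y = 0) : y = 0 := by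
  funext j
  have hj : ((b * (y j).val : ℕ) : ZMod (b * M)) = 0 := congr_fun h j
  rw [ZMod.natCast_eq_zero_iff] at hj
  have hM : M ∣ (y j).val := Nat.dvd_of_mul_dvd_mul_left hb hj
  have h0 : (y j).val = 0 := Nat.eq_zero_of_dvd_of_lt hM (ZMod.val_lt (y j))
  exact (ZMod.val_eq_zero (y j)).1 h0

/-- The corner `b·0` is the fine origin. [folklore] -/
theorem liftSite_zero (b M : ℕ) : liftSite b M (0 : Site 3 M) = 0 := by
  funext i
  simp [liftSite]

/-- For `2 ≤ b`: the end-point `b·y + eᵢ` of a star link is the fine site `e₀` only for the link `(0, 0)`. [folklore] -/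
theorem liftSite_shift_eq_single_iff {b M : ℕ} [NeZero M] (h2 : 2 ≤ b) (y : Site 3 M) (i : Fin 3) :
    (liftSite b M y).shift i = Pi.single (0 : Fin 3) (1 : ZMod (b * M)) ↔ y = 0 ∧ i = 0 := by
  constructor
  · intro h
    by_cases hi : i = 0
    · subst hi
      have h' : liftSite b M y = 0 := by
        have : liftSite b M y + Pi.single (0 : Fin 3) (1 : ZMod (b * M)) = 0 + Pi.single 0 1 := by
          rw [zero_add]; exact h
        exact add_right_cancel this
      exact ⟨liftSite_eq_zero (lt_of_lt_of_le (by norm_num) h2) h', rfl⟩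
    · exfalso
      have hc := congr_fun h i
      simp only [Site.shift, Pi.add_apply, Pi.single_eq_same, liftSite, Pi.single_eq_of_ne hi] at hc
      exact liftCoord_add_one_ne_zero h2 M _ hc
  · rintro ⟨rfl, rfl⟩
    rw [liftSite_zero]
    simp [Site.shift]

/-- For `2 ≤ b`: no corner `b·y` is the fine site `e₀`. [folklore] -/
theorem liftSite_ne_single {b M : ℕ} (h2 : 2 ≤ b) (y : Site 3 M) :
    liftSite b M y ≠ Pi.single (0 : Fin 3) (1 : ZMod (b * M)) := by
  intro h
  have hc := congr_fun h 0
  simp only [liftSite, Pi.single_eq_same] at hc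
  exact liftCoord_ne_one h2 M _ hc

end ForestGeometry

section Forest

variable {G : Type} [MeasurableSpace G] [Group G]

/-- **The forest is NOT gauge-covariant (PROVED).** For `2 ≤ b β`, on every coarse torus `M ≥ 1`, for EVERY re-labelling
`emb`, star decimation violates Bałaban's (11) as soon as `G` has an element `a ≠ 1`. Witness: `U ≡ 1` and the rotation
`g = a` at the single fine site `e₀ = b·0 + e₀`, `g = 1` elsewhere: the decimated field is `a⁻¹` on the coarse link `(0,0)`
and `1` on every other link, while `(blk 1)^{g ∘ emb} = 1^{h}` is a pure gauge, whose links around the coarse plaquette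
`(0; 0, 1)` force `h 0 = h e₀` — contradiction (`M = 1`: the coarse shift is trivial, same contradiction). This is the
property that separates Bałaban's block averages from the forest witness of `ForestWitness3`. [folklore] -/
theorem not_covariantAt_forestFamily {b : ℝ → ℕ} {hb : ∀ β, 0 < b β} {β : ℝ} (h2 : 2 ≤ b β) (M : ℕ) [NeZero M]
    (hG : ∃ a : G, a ≠ 1) (emb : Site 3 M → Site 3 (b β * M)) :
    ¬ (forestFamily (G := G) b hb).CovariantAt β M emb := by
  obtain ⟨a, ha⟩ := hG
  intro hcov
  -- the gauge rotation by `a` at the single fine site `e₀ = (1, 0, 0)`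
  let g : Site 3 (b β * M) → G := Pi.mulSingle (Pi.single (0 : Fin 3) (1 : ZMod (b β * M))) a
  have g_s : g (Pi.single (0 : Fin 3) (1 : ZMod (b β * M))) = a := by
    simp only [g, Pi.mulSingle_eq_same]
  have g_of_ne : ∀ x : Site 3 (b β * M), x ≠ Pi.single (0 : Fin 3) (1 : ZMod (b β * M)) → g x = 1 :=
    fun x hx => by simp only [g, Pi.mulSingle_eq_of_ne hx]
  have key := hcov g (fun _ => 1)
  -- both sides, evaluated at a coarse link `(y, i)`
  have hL : ∀ (y : Site 3 M) (i : Fin 3),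
      (forestFamily (G := G) b hb).blk β M (gaugeTransform g fun _ => 1) (y, i) =
        (g ((liftSite (b β) M y).shift i))⁻¹ := by
    intro y i
    show gaugeTransform g (fun _ => (1 : G)) (liftSite (b β) M y, i) = _
    simp only [gaugeTransform, mul_one]
    rw [g_of_ne _ (liftSite_ne_single h2 y), one_mul]
  have hR : ∀ (y : Site 3 M) (i : Fin 3),
      gaugeTransform (fun y => g (emb y)) ((forestFamily (G := G) b hb).blk β M fun _ => 1) (y, i) =
        g (emb y) * (g (emb (y.shift i)))⁻¹ := by
    intro y i
    show g (emb y) * (1 : G) * (g (emb (y.shift i)))⁻¹ = _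
    rw [mul_one]
  have hE : ∀ (y : Site 3 M) (i : Fin 3),
      (g ((liftSite (b β) M y).shift i))⁻¹ = g (emb y) * (g (emb (y.shift i)))⁻¹ := by
    intro y i
    rw [← hL, ← hR, key]
  -- the link `(0, 0)`: value `a⁻¹`
  have h00 : g (emb 0) * (g (emb ((0 : Site 3 M).shift 0)))⁻¹ = a⁻¹ := by
    rw [← hE, (liftSite_shift_eq_single_iff h2 0 0).2 ⟨rfl, rfl⟩, g_s]
  -- every other link: value `1`
  have hone : ∀ (y : Site 3 M) (i : Fin 3), ¬ (y = 0 ∧ i = 0) → g (emb y) = g (emb (y.shift i)) := by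
    intro y i hyi
    have h1 : (g ((liftSite (b β) M y).shift i))⁻¹ = 1 := by
      rw [g_of_ne _ (fun h => hyi ((liftSite_shift_eq_single_iff h2 y i).1 h)), inv_one]
    have := hE y i
    rw [h1] at this
    exact mul_inv_eq_one.1 this.symm
  -- the chain around the coarse plaquette `(0; 0, 1)` (or the trivial shift when `M = 1`)
  have hshift : g (emb 0) = g (emb ((0 : Site 3 M).shift 0)) := by
    by_cases he : ((0 : Site 3 M).shift 1) = 0
    · -- `M = 1`: then `e₀ = 0` as well
      have h10 : (1 : ZMod M) = 0 := by
        have := congr_fun he 1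
        simpa [Site.shift] using this
      have : (0 : Site 3 M).shift 0 = 0 := by
        funext j; simp [Site.shift, h10]
      rw [this]
    · have e1 : g (emb 0) = g (emb ((0 : Site 3 M).shift 1)) := hone 0 1 (by simp)
      have e2 : g (emb ((0 : Site 3 M).shift 1)) = g (emb (((0 : Site 3 M).shift 1).shift 0)) :=
        hone _ 0 (fun h => he h.1)
      have e3 : g (emb ((0 : Site 3 M).shift 0)) = g (emb (((0 : Site 3 M).shift 0).shift 1)) :=
        hone _ 1 (by simp)
      have e4 : ((0 : Site 3 M).shift 1).shift 0 = ((0 : Site 3 M).shift 0).shift 1 := by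
        simp only [Site.shift]; abel
      rw [e1, e2, e4, ← e3]
  rw [← hshift, mul_inv_cancel] at h00
  exact ha (inv_eq_one.1 h00.symm)

/-- **Corollary: the forest family is not gauge-covariant along any coupling set meeting `{β | 2 ≤ b β}`** (nontrivial `G`).
Hence the forest witness of theory-2's `ForestWitness3` is unavailable for `IRConjecture3Cov` below. [folklore] -/
theorem not_isGaugeCovariantOn_forestFamily {b : ℝ → ℕ} {hb : ∀ β, 0 < b β} {I : Set ℝ} {β : ℝ} (hβ : β ∈ I)
    (h2 : 2 ≤ b β) (hG : ∃ a : G, a ≠ 1) : ¬ (forestFamily (G := G) b hb).IsGaugeCovariantOn I := by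
  intro h
  obtain ⟨emb, hemb⟩ := h β hβ 1
  exact not_covariantAt_forestFamily h2 1 hG emb hemb

/-- `SU(2)` has an element `≠ 1`: the centre element `-1` (its `(0,0)` entry is `-1 ≠ 1`). [folklore] -/
theorem exists_ne_one_SU2 : ∃ a : RobustBall.SUN 2, a ≠ 1 := by
  refine ⟨⟨-1, ?_⟩, ?_⟩
  · rw [Matrix.mem_specialUnitaryGroup_iff]
    refine ⟨?_, ?_⟩
    · rw [Matrix.mem_unitaryGroup_iff]
      simp
    · simp [Matrix.det_neg]
  · intro h
    have h' := congrArg (fun x : RobustBall.SUN 2 => (x : Matrix (Fin 2) (Fin 2) ℂ) 0 0) h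
    norm_num at h'

end Forest

/-! ## 3. The covariant form of the one conjecture and the SU(2) sentence on the TIER-2 ball -/

section Conjecture

variable {G : Type} [MeasurableSpace G] {N : ℕ} [Group G] [TopologicalSpace G] [IsTopologicalGroup G]
  [CompactSpace G] [BorelSpace G]

/-- **`IRConjecture3Cov B r ρ I C_b κ` (CONJECTURE; NOT in print):** ONE block family that is GAUGE-COVARIANT and
BLOCK-LOCAL along `I` (Bałaban's (11) and the locality of his average (15)) whose coarse laws enter the cluster domain
with a linear block factor AND whose fluctuation field decouples. The forest witness of `ForestWitness3` is excluded
(`not_isGaugeCovariantOn_forestFamily`), so — unlike `IRConjecture3` — this is not known to follow from the target: a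
genuine SUFFICIENT condition (reverse arrow = Gibbsian restoration, not in print for gauge theories). Why it might fail: non-Gibbsian coarse laws (vEFS 1993) for
Bałaban-type averages at intermediate coupling; large fields. `BalabanUV3` is still not load-bearing here (clause (a) is
asserted outright). [cite: Balaban1985Averaging, (11), (15) p.19] -/
@[conjecture] def IRConjecture3Cov (B : BallSpec G N) (r : G → G → ℝ) (ρ : G →* Matrix (Fin N) (Fin N) ℂ)
    (I : Set ℝ) (C_b κ : ℝ) : Prop :=
  ∃ W : BlockFamily G, W.IsGaugeCovariantOn I ∧ W.IsBlockLocalOn I ∧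
    EntersClusterDomain B ρ W I C_b ∧ FluctuationDecoupling r ρ W I κ

/-- The covariant conjecture implies the conjecture of record (forget the two structural clauses). [folklore] -/
theorem irConjecture3_of_cov {B : BallSpec G N} {r : G → G → ℝ} {ρ : G →* Matrix (Fin N) (Fin N) ℂ} {I : Set ℝ}
    {C_b κ : ℝ} (h : IRConjecture3Cov B r ρ I C_b κ) : IRConjecture3 B r ρ I C_b κ := by
  obtain ⟨W, _, _, ha, hb⟩ := h
  exact ⟨W, ha, hb⟩

end Conjecture

/-- **`SU(2)` lattice YM₃ mass gap on Bałaban's coupling set from print ∧ the COVARIANT conjecture on the TIER-2 ball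
(PROVED bookkeeping; the §Y4 sentence shape of record, receiving on the weighted ball).** Y2's input is ds-2's
hypothesis-free tier-2 row `RobustBall.su2_clusterDomainClusteringW_dim3_oneEighth_w65` — ball `ClusterDomain (log 6/5)
(9/25) (9/50)`, Wilson ceiling `1/16` in tree units (`β_W = 1/8`), rate `log (6/5)`, its positivity `RobustBall.log_sixFifths_pos_and_log_threeHalves_pos` — consumed BY NAME; Bałaban's
`BalabanUV3 mk` enters as in the sentence of record (evidential, see the module docstring). [cite: Balaban1985UV3, Thm 1 p.257; Thm 2 p.272] -/
theorem massGap3Cofinal_su2_W_of_irConjecture3Cov {L : ℕ} {mk : Construction L} {eps0 : ℝ → ℝ}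
    (hfam : Nonempty (Family L eps0)) {C_b κ : ℝ} (hC : 0 < C_b) (hκ : 0 < κ) (hUV : BalabanUV3 mk)
    (hIR : IRConjecture3Cov (ballOfRobustBall 2 (Real.log (6 / 5)) (9 / 25) (9 / 50) (1 / 16)) suFrobDist
      (fundamentalRep (Fin 2)) (CarrierBridge.balabanCouplings L (suGroupModel 2) eps0) C_b κ) :
    MassGap3Cofinal (CarrierBridge.balabanCouplings L (suGroupModel 2) eps0) suFrobDist
      (fundamentalRep (Fin 2) : RobustBall.SUN 2 →* Matrix (Fin 2) (Fin 2) ℂ) :=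
  massGap3Cofinal_suN_balaban_of_irConjecture3 hfam hC hκ RobustBall.log_sixFifths_pos_and_log_threeHalves_pos.1 hUV
    RobustBall.su2_clusterDomainClusteringW_dim3_oneEighth_w65 (irConjecture3_of_cov hIR)

/-- **The same, PRINT-FREE (theory-2's F2 shape: `BalabanUV3 mk` and `mk` deleted; PROVED bookkeeping).** What remains of
print is the index set `balabanCouplings` and its unboundedness. [cite: Balaban1985UV3, p.256 L15–18] -/
theorem massGap3Cofinal_su2_W_of_irConjecture3Cov_printFree {L : ℕ} {eps0 : ℝ → ℝ}
    (hfam : Nonempty (Family L eps0)) {C_b κ : ℝ} (hC : 0 < C_b) (hκ : 0 < κ)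
    (hIR : IRConjecture3Cov (ballOfRobustBall 2 (Real.log (6 / 5)) (9 / 25) (9 / 50) (1 / 16)) suFrobDist
      (fundamentalRep (Fin 2)) (CarrierBridge.balabanCouplings L (suGroupModel 2) eps0) C_b κ) :
    MassGap3Cofinal (CarrierBridge.balabanCouplings L (suGroupModel 2) eps0) suFrobDist
      (fundamentalRep (Fin 2) : RobustBall.SUN 2 →* Matrix (Fin 2) (Fin 2) ℂ) :=
  massGap3Cofinal_of_irConjecture3_printFree (CarrierBridge.not_bddAbove_balabanCouplings (suGroupModel 2) hfam) hC hκ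
    RobustBall.log_sixFifths_pos_and_log_threeHalves_pos.1 (suFrobDist_bddAbove 2)
    RobustBall.su2_clusterDomainClusteringW_dim3_oneEighth_w65
    (irConjecture3_of_cov hIR)

/-- **On Bałaban's coupling set the forest is excluded from `IRConjecture3Cov` (PROVED):** for any block-factor function
with `2 ≤ b β` at some `β ∈ balabanCouplings L (suGroupModel 2) eps0`, the forest family is not gauge-covariant there
(`SU(2) ∋ -1 ≠ 1`). [folklore] -/
theorem forestFamily_not_covariant_on_balabanCouplings {L : ℕ} {eps0 : ℝ → ℝ} {b : ℝ → ℕ} {hb : ∀ β, 0 < b β}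
    {β : ℝ} (hβ : β ∈ CarrierBridge.balabanCouplings L (suGroupModel 2) eps0) (h2 : 2 ≤ b β) :
    ¬ (forestFamily (G := RobustBall.SUN 2) b hb).IsGaugeCovariantOn
        (CarrierBridge.balabanCouplings L (suGroupModel 2) eps0) :=
  not_isGaugeCovariantOn_forestFamily hβ h2 exists_ne_one_SU2

end Summit.Ventures.YMGap.YM3IR

end
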